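import Mathlib
import Summits.ResolutionOfSingularities.ResolutionOfSingularities.Theorems.RadicialJungCleanModelsCleanProp44CornerPointUnique
import HarnessLib

/-!
# Route `RadicialJung`, crux `CleanModels` (stmt-ResolutionOfSingularities-15917), line `Sketch` rev 35, stub 6 `stub_cleanProp44` (X44c):
# AT MOST ONE VERTEX OBSTRUCTION PER NEAR LINE (global count (iv), vertices)

Seat decomp-res-hand-2 g19 (structural hand); sequel of ✓ `…CleanProp44CornerPointUnique.lean`.  Hand-2 g18's endpoint
✓ `cleanPermissibleAt_nearLine_or_vertex_or_cross` describes a VERTEX obstruction of the near line of `y = Σ_k m_k c_k` at a point `x'` over the blown-up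
clean threefold point `x` by an ordering `(i, k₁, k₂)` of `Fin 3` with the sides `c_{k₁}, c_{k₂}` passing through `x'`, `m_i ∈ 𝔪_x` and `m_{k₁}, m_{k₂} ∉ 𝔪_x`.
The pair `{k₁, k₂} = {k : m_k ∉ 𝔪_x}` is thus DETERMINED BY THE LINE, and by ✓ `eq_of_twoSides_of_twoSides` the point through which both sides pass is
unique:

* `eq_of_vertexObstruction_of_vertexObstruction` — two points over `x` carrying vertex obstructions of the SAME near line (same coefficients `m`) coincide.
  So a near line meets at most ONE vertex obstruction, and over `x` there are at most three (one per pair of sides) — the count (iv) of memo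
  `Sketch-memo-hand2-g18-stubs-5-7.md` §2 (a) for vertices, without constructing `E_x ≅ ℙ²`.

Honest framing: OURS, bookkeeping.  Nothing here proves X44c, any case of `CleanModels`, or resolution of singularities in characteristic `p`.
Setting only: [cite: CossartPiltant2008, Lemma 4.3 (3), (5); Prop. 4.4 (proof, p. 11)] [cite: StacksProject, Tag 0804].
-/

noncomputable section

set_option linter.dupNamespace false -- mandated namespace of this single-conjunct summit

open IsLocalRing CategoryTheory AlgebraicGeometry
open Literature.AlgebraicGeometry.Resolution Literature.AlgebraicGeometry.Motives

namespace Summit.ResolutionOfSingularities.ResolutionOfSingularities.Theorems.RadicialJung.CleanModels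

universe u

section Scheme

variable {X X' : Scheme.{u}} {τ : X' ⟶ X} {J : X.IdealSheafData}

set_option maxHeartbeats 800000 in
-- long statement, short proof
/-- **At most one vertex obstruction per near line.**  See the module docstring: `y₁, y₂` over `s`, at `y₁` the sides `k₁ ≠ k₂` pass with
`m_{k₁}, m_{k₂} ∉ 𝔪_s` and `m_i ∈ 𝔪_s` for the third index `i`; at `y₂` the sides `l₁ ≠ l₂` pass with `m_{l₁}, m_{l₂} ∉ 𝔪_s`; then `y₁ = y₂`.
[cite: CossartPiltant2008, Lemma 4.3 (3), (5); Prop. 4.4 (proof, p. 11)] [cite: StacksProject, Tag 0804] -/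
theorem eq_of_vertexObstruction_of_vertexObstruction (hτ : IsBlowup τ J) {s : X} (hR : IsRegularLocalRing (X.presheaf.stalk s))
    (c : Fin 3 → X.presheaf.stalk s) (hc : Ideal.span (Set.range c) = maximalIdeal (X.presheaf.stalk s))
    (hd : (maximalIdeal (X.presheaf.stalk s)).spanFinrank = 3) (hcJ : Ideal.span (Set.range c) = stalkIdeal J s)
    (m : Fin 3 → X.presheaf.stalk s) {y₁ y₂ : X'} (hy₁ : τ y₁ = s) (hy₂ : τ y₂ = s)
    {i k₁ k₂ : Fin 3} (hik₁ : i ≠ k₁) (hik₂ : i ≠ k₂) (hk : k₁ ≠ k₂)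
    (hmi : m i ∈ maximalIdeal (X.presheaf.stalk s)) (hm₁ : m k₁ ∉ maximalIdeal (X.presheaf.stalk s)) (hm₂ : m k₂ ∉ maximalIdeal (X.presheaf.stalk s))
    (h₁₁ : Ideal.span {((τ.stalkMap y₁).hom.comp (X.presheaf.stalkCongr (.of_eq hy₁.symm)).hom.hom) (c k₁)} ≠
      (maximalIdeal (X.presheaf.stalk s)).map ((τ.stalkMap y₁).hom.comp (X.presheaf.stalkCongr (.of_eq hy₁.symm)).hom.hom))
    (h₁₂ : Ideal.span {((τ.stalkMap y₁).hom.comp (X.presheaf.stalkCongr (.of_eq hy₁.symm)).hom.hom) (c k₂)} ≠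
      (maximalIdeal (X.presheaf.stalk s)).map ((τ.stalkMap y₁).hom.comp (X.presheaf.stalkCongr (.of_eq hy₁.symm)).hom.hom))
    {l₁ l₂ : Fin 3} (hl : l₁ ≠ l₂)
    (hml₁ : m l₁ ∉ maximalIdeal (X.presheaf.stalk s)) (hml₂ : m l₂ ∉ maximalIdeal (X.presheaf.stalk s))
    (h₂₁ : Ideal.span {((τ.stalkMap y₂).hom.comp (X.presheaf.stalkCongr (.of_eq hy₂.symm)).hom.hom) (c l₁)} ≠
      (maximalIdeal (X.presheaf.stalk s)).map ((τ.stalkMap y₂).hom.comp (X.presheaf.stalkCongr (.of_eq hy₂.symm)).hom.hom))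
    (h₂₂ : Ideal.span {((τ.stalkMap y₂).hom.comp (X.presheaf.stalkCongr (.of_eq hy₂.symm)).hom.hom) (c l₂)} ≠
      (maximalIdeal (X.presheaf.stalk s)).map ((τ.stalkMap y₂).hom.comp (X.presheaf.stalkCongr (.of_eq hy₂.symm)).hom.hom)) :
    y₁ = y₂ := by
  -- the pair of sides is determined by the line: `{l₁, l₂} = {k₁, k₂} = {k : m_k ∉ 𝔪_s}`
  obtain ⟨i', hi'₁, hi'₂, huniv⟩ := exists_third_fin_three k₁ k₂ hk
  have hii' : i = i' := by
    rcases huniv i with h | h | h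
    · exact h
    · exact absurd h hik₁
    · exact absurd h hik₂
  subst hii'
  have hmem : ∀ l, m l ∉ maximalIdeal (X.presheaf.stalk s) → l = k₁ ∨ l = k₂ := by
    intro l hl
    rcases huniv l with h | h | h
    · exact absurd (h ▸ hmi) hl
    · exact Or.inl h
    · exact Or.inr h
  rcases hmem l₁ hml₁ with h₁ | h₁ <;> rcases hmem l₂ hml₂ with h₂ | h₂
  · exact absurd (h₁.trans h₂.symm) hl
  · subst h₁; subst h₂
    exact eq_of_twoSides_of_twoSides hτ hR c hc hd hcJ hk hy₁ hy₂ h₁₁ h₁₂ h₂₁ h₂₂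
  · subst h₁; subst h₂
    exact eq_of_twoSides_of_twoSides hτ hR c hc hd hcJ hk hy₁ hy₂ h₁₁ h₁₂ h₂₂ h₂₁
  · exact absurd (h₁.trans h₂.symm) hl

end Scheme

end Summit.ResolutionOfSingularities.ResolutionOfSingularities.Theorems.RadicialJung.CleanModels

end
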